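import Summits.NavierStokesRegularity.NavierStokesRegularity.Theorems.RecurrentProfilesRecurrentLiouvillePrProximalReduction
import Summits.NavierStokesRegularity.NavierStokesRegularity.Theorems.RecurrentProfilesRecurrentLiouvillePrHullDichotomy
import Summits.NavierStokesRegularity.NavierStokesRegularity.Theorems.RecurrentProfilesRecurrentLiouvillePrJointContinuity
import Summits.NavierStokesRegularity.NavierStokesRegularity.Theorems.SqueezeCycleRecurrentLiouvilleNearIdentityDSS
import HarnessLib

/-!
# Crux `RecurrentLiouville` (stmt-NavierStokesRegularity-1589), line `Sketch` v9 — stub T6: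
# the BLOW-UP DICHOTOMY for Type-I singularities

`stub_prBlowupDichotomy` (composition of H3 `stub_prProximalReduction`, T4 `stub_prHullDichotomy`
and T1 `stub_prJointContinuity`).  Class: suitable weak solutions `(u, p)` of Navier–Stokes
(`ν = 1`, `f = 0`) on the backward slab `ℝ₋ × ℝ³` with weak gradient `G`, Albritton–Barker
quantity `𝐈 < ⊤` and the Type-I rate `‖u(t,x)‖ ≤ C/√(−t)`; write `u_λ(t,x) = λ u(λ²t, λx)`
(`nsRescale λ u`) and `Q(0,R) = ]-R²,0[ × B(0,R)` (`parabolicCylinder R 0`).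

**Statement.**  If a class member `u` is singular at the origin, then EITHER
* (DSS BLOW-UP LIMIT) there are a class member `w` with the same `C`, singular at the origin and
  a.e. DISCRETELY SELF-SIMILAR (`w_μ = w` a.e. on the slab for some factor `μ > 1`), and blow-up
  scales `λₙ → 0⁺` with `u_{λₙ} → w` in `L³(Q(0,R))` for every `R > 0`; OR
* (DSS-FREE RECURRENT SHADOW) there are a UNIFORMLY RECURRENT class member `w` with the same `C`,
  singular at the origin, no `L³_loc`-limit of rescalings of which is a.e. `e^σ`-self-similar for
  any `σ ≠ 0`, and blow-up scales `λₙ → 0⁺` with `‖u_{λₙ} − w_{λₙ}‖_{L³(K)} → 0` for every compact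
  `K ⊆ {t ≤ 0} × ℝ³`.

**Proof.**  H3 gives the recurrent shadow `w` and the scales `λₙ → 0⁺`.  T4 for `w` (bound
`M = 𝐈(w)`): either the scaling stabiliser of `w` is `σ₀ℤ` with `σ₀ ≥ log Λ > 0`, or the whole hull
of `w` is DSS-free — the second alternative, verbatim.  In the periodic case write
`log λₙ = kₙσ₀ + rₙ`, `kₙ = ⌊log λₙ/σ₀⌋`, `rₙ ∈ [0, σ₀]`; as `w_{e^{kₙσ₀}} = w` a.e. and a.e.
identities transport along parabolic dilations, `w_{λₙ} = w_{e^{rₙ}}` a.e. on the slab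
(`prBD_reduce_scales`).  By Bolzano–Weierstrass `r_{φ(n)} → r*` along a subsequence, and
`w' = w_{e^{r*}}` is a class member with the same `𝐈` and `C`, singular at the origin (the class is
scale invariant: `zoom_slabProfile`, `isBackwardSingularPoint_zoom`) and a.e. `e^{σ₀}`-self-similar
(rescalings commute).  Finally, with the compact `K_R = [−R², 0] × B̄(0,R) ⊇ Q(0,R)`,
`‖u_{λ_{φ(n)}} − w'‖_{L³(Q(0,R))} ≤ ‖u_{λ_{φ(n)}} − w_{λ_{φ(n)}}‖_{L³(K_R)} + ‖w_{e^{r_{φ(n)}}} − w_{e^{r*}}‖_{L³(Q(0,R))} → 0`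
by H3 and the joint continuity of the scaling flow (T1, constant sequence).

## References

* H. Furstenberg, *Recurrence in Ergodic Theory and Combinatorial Number Theory* (1981), Ch. 8,
  Thm. 8.7 and Ch. 1 §4, Thm. 1.17. [Furstenberg1981]
* D. Albritton, T. Barker, J. Math. Fluid Mech. 21 (2019), no. 43 = arXiv:1811.00502, Lemma 2.2,
  Prop. 2.3. [AlbrittonBarker2019]
-/

noncomputable section

-- the sub-problem namespace repeats the summit name (D-0017 layout `Summit.<S>.<P>.Theorems`)
set_option linter.dupNamespace false

namespace Summit.NavierStokesRegularity.NavierStokesRegularity.Theorems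

open MeasureTheory Set Function Filter Topology TopologicalSpace Metric
open Literature.Analysis Literature.Analysis.FluidPDE
open scoped NNReal ENNReal

/-- Rescalings of a slab profile with `𝐈 < ∞` lie in `L³(Q(0, R))` for every `R > 0`. [folklore] -/
private theorem prBD_memLp_nsRescale
    {u : ℝ → EuclideanSpace ℝ (Fin 3) → EuclideanSpace ℝ (Fin 3)}
    {p : ℝ → EuclideanSpace ℝ (Fin 3) → ℝ}
    {G : ℝ → EuclideanSpace ℝ (Fin 3) → EuclideanSpace ℝ (Fin 3) →L[ℝ] EuclideanSpace ℝ (Fin 3)}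
    (hwg : HasWeakSpatialGradientOn (slab (EuclideanSpace ℝ (Fin 3)) (Iio 0) isOpen_Iio) u G)
    (hI : typeIBound (Iio (0 : ℝ) ×ˢ univ) u p G < ⊤) {c : ℝ} (hc : 0 < c) {R : ℝ} (hR : 0 < R) :
    MemLp (uncurry (nsRescale c u)) 3
      (volume.restrict (parabolicCylinder R (0 : ℝ × EuclideanSpace ℝ (Fin 3)))) := by
  rw [nsRescale_eq_zoom c u]
  exact memLp_three_zoom hc (memLp_three_of_slabProfile hwg hI (mul_pos hc hR))

/-- `Q(0, R) ⊆ [−R², 0] × B̄(0, R)`. [folklore] -/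
private theorem prBD_cylinder_subset (R : ℝ) :
    parabolicCylinder R (0 : ℝ × EuclideanSpace ℝ (Fin 3)) ⊆
      Icc (-R ^ 2) 0 ×ˢ closedBall (0 : EuclideanSpace ℝ (Fin 3)) R := by
  intro z hz
  rw [SuitableCompactness.mem_parabolicCylinder_zero] at hz
  exact ⟨⟨hz.1.1.le, hz.1.2.le⟩, mem_closedBall_zero_iff.2 hz.2.le⟩

/-- **Reduction of the blow-up scales modulo a period.**  If `w_{e^{kσ₀}} = w` a.e. on the slab
for every `k ∈ ℤ` (`σ₀ > 0`) and `λₙ > 0`, then `w_{λₙ} = w_{e^{rₙ}}` a.e. on the slab for some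
`rₙ ∈ [0, σ₀]`: `log λₙ = kₙσ₀ + rₙ` with `kₙ = ⌊log λₙ/σ₀⌋`, `w_{λₙ} = (w_{e^{rₙ}})_{e^{kₙσ₀}}`, and
the a.e. symmetry transports along the parabolic dilation by `e^{rₙ}`. [folklore] -/
private theorem prBD_reduce_scales
    {w : ℝ → EuclideanSpace ℝ (Fin 3) → EuclideanSpace ℝ (Fin 3)} {σ₀ : ℝ} (hσ₀ : 0 < σ₀)
    (hstab : ∀ k : ℤ, ∀ᵐ z ∂(volume.restrict (Iio (0 : ℝ) ×ˢ (univ : Set (EuclideanSpace ℝ (Fin 3))))),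
      nsRescale (Real.exp ((k : ℝ) * σ₀)) w z.1 z.2 = w z.1 z.2)
    {lam : ℕ → ℝ} (hlam : ∀ n, 0 < lam n) :
    ∃ r : ℕ → ℝ, (∀ n, r n ∈ Icc 0 σ₀) ∧ ∀ n,
      ∀ᵐ z ∂(volume.restrict (Iio (0 : ℝ) ×ˢ (univ : Set (EuclideanSpace ℝ (Fin 3))))),
        nsRescale (lam n) w z.1 z.2 = nsRescale (Real.exp (r n)) w z.1 z.2 := by
  refine ⟨fun n => Int.fract (Real.log (lam n) / σ₀) * σ₀, fun n => ⟨?_, ?_⟩, fun n => ?_⟩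
  · exact mul_nonneg (Int.fract_nonneg _) hσ₀.le
  · have h := mul_le_mul_of_nonneg_right (Int.fract_lt_one (Real.log (lam n) / σ₀)).le hσ₀.le
    rwa [one_mul] at h
  · have e : lam n = Real.exp (Int.fract (Real.log (lam n) / σ₀) * σ₀) *
        Real.exp ((⌊Real.log (lam n) / σ₀⌋ : ℝ) * σ₀) := by
      rw [← Real.exp_add, ← add_mul, Int.fract_add_floor, div_mul_cancel₀ _ hσ₀.ne',
        Real.exp_log (hlam n)]
    have e' : nsRescale (lam n) w = nsRescale (Real.exp ((⌊Real.log (lam n) / σ₀⌋ : ℝ) * σ₀))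
        (nsRescale (Real.exp (Int.fract (Real.log (lam n) / σ₀) * σ₀)) w) := by
      rw [← nsRescale_mul, ← e]
    have h := prSL_ae_nsRescale_comm_of_ae (u := w)
      (c := Real.exp ((⌊Real.log (lam n) / σ₀⌋ : ℝ) * σ₀))
      (Real.exp_pos (Int.fract (Real.log (lam n) / σ₀) * σ₀)) (hstab _)
    filter_upwards [h] with z hz
    rw [e']
    exact hz

/-- **T6 · BLOW-UP DICHOTOMY FOR TYPE-I SINGULARITIES** (composition of H3 and T4).  Every Type-I
singularity model `u` (suitable weak slab solution, weak gradient, `𝐈 < ⊤`, rate `C`, singular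
origin) EITHER has an a.e. DISCRETELY SELF-SIMILAR BLOW-UP LIMIT — a class member `w` (same `C`,
singular, `w_μ = w` a.e. for some factor `μ > 1`) with `u_{λₙ} → w` in every `L³(Q(0,R))` along some
blow-up scales `λₙ → 0⁺` —, OR it shadows along blow-up scales `λₙ → 0⁺`
(`‖u_{λₙ} − w_{λₙ}‖_{L³(K)} → 0`, every compact `K ⊆ {t ≤ 0} × ℝ³`) a UNIFORMLY RECURRENT singularity
model `w` (same class, same `C`) whose entire `L³_loc` hull is DSS-FREE (no limit of rescalings of
`w` is a.e. `e^σ`-self-similar for any `σ ≠ 0`).  Proof: H3 gives the recurrent shadow `w` and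
`λₙ → 0`; T4 for `w`: in the periodic case `Stab(w) = σ₀ℤ`, write `log λₙ = kₙσ₀ + rₙ`,
`rₙ ∈ [0, σ₀]`, so `w_{λₙ} = w_{e^{rₙ}}` a.e.; a subsequence `rₙ → r*` and joint continuity (T1) give
`u_{λₙ} → w_{e^{r*}}`, an a.e.-DSS class member; otherwise the hull of `w` is DSS-free.
[cite: Furstenberg1981, Ch. 8, Thm. 8.7 and Ch. 1 §4, Thm. 1.17] -/
theorem stub_prBlowupDichotomy :
    ∀ (u : ℝ → EuclideanSpace ℝ (Fin 3) → EuclideanSpace ℝ (Fin 3)) (p : ℝ → EuclideanSpace ℝ (Fin 3) → ℝ) (G : ℝ → EuclideanSpace ℝ (Fin 3) → EuclideanSpace ℝ (Fin 3) →L[ℝ] EuclideanSpace ℝ (Fin 3)) (C : ℝ),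
      IsSuitableWeakSolutionOn (slab (EuclideanSpace ℝ (Fin 3)) (Iio 0) isOpen_Iio) 1 0 u p →
      HasWeakSpatialGradientOn (slab (EuclideanSpace ℝ (Fin 3)) (Iio 0) isOpen_Iio) u G →
      typeIBound (Iio (0 : ℝ) ×ˢ univ) u p G < ⊤ →
      HasTypeITimeDecay C u →
      IsBackwardSingularPoint u 0 →
      (∃ (w : ℝ → EuclideanSpace ℝ (Fin 3) → EuclideanSpace ℝ (Fin 3)) (q : ℝ → EuclideanSpace ℝ (Fin 3) → ℝ) (H : ℝ → EuclideanSpace ℝ (Fin 3) → EuclideanSpace ℝ (Fin 3) →L[ℝ] EuclideanSpace ℝ (Fin 3)),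
        IsSuitableWeakSolutionOn (slab (EuclideanSpace ℝ (Fin 3)) (Iio 0) isOpen_Iio) 1 0 w q ∧
        HasWeakSpatialGradientOn (slab (EuclideanSpace ℝ (Fin 3)) (Iio 0) isOpen_Iio) w H ∧
        typeIBound (Iio (0 : ℝ) ×ˢ univ) w q H < ⊤ ∧
        HasTypeITimeDecay C w ∧
        IsBackwardSingularPoint w 0 ∧
        (∃ μ : ℝ, 1 < μ ∧ ∀ᵐ z ∂(volume.restrict (Iio (0 : ℝ) ×ˢ (univ : Set (EuclideanSpace ℝ (Fin 3))))), nsRescale μ w z.1 z.2 = w z.1 z.2) ∧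
        ∃ lam : ℕ → ℝ, (∀ n, 0 < lam n) ∧ Tendsto lam atTop (𝓝 0) ∧
          ∀ R : ℝ, 0 < R → Tendsto (fun n => eLpNorm (uncurry (nsRescale (lam n) u) - uncurry w) 3
            (volume.restrict (parabolicCylinder R (0 : ℝ × EuclideanSpace ℝ (Fin 3))))) atTop (𝓝 0)) ∨
      (∃ (w : ℝ → EuclideanSpace ℝ (Fin 3) → EuclideanSpace ℝ (Fin 3)) (q : ℝ → EuclideanSpace ℝ (Fin 3) → ℝ) (H : ℝ → EuclideanSpace ℝ (Fin 3) → EuclideanSpace ℝ (Fin 3) →L[ℝ] EuclideanSpace ℝ (Fin 3)),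
        IsSuitableWeakSolutionOn (slab (EuclideanSpace ℝ (Fin 3)) (Iio 0) isOpen_Iio) 1 0 w q ∧
        HasWeakSpatialGradientOn (slab (EuclideanSpace ℝ (Fin 3)) (Iio 0) isOpen_Iio) w H ∧
        typeIBound (Iio (0 : ℝ) ×ˢ univ) w q H < ⊤ ∧
        HasTypeITimeDecay C w ∧
        IsBackwardSingularPoint w 0 ∧
        IsScalingUniformlyRecurrent w ∧
        (∀ (v : ℝ → EuclideanSpace ℝ (Fin 3) → EuclideanSpace ℝ (Fin 3)) (lam : ℕ → ℝ),
          (∀ R : ℝ, 0 < R → MemLp (uncurry v) 3 (volume.restrict (parabolicCylinder R (0 : ℝ × EuclideanSpace ℝ (Fin 3))))) →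
          (∀ n, 0 < lam n) →
          (∀ R : ℝ, 0 < R → Tendsto (fun n => eLpNorm (uncurry (nsRescale (lam n) w) - uncurry v) 3
            (volume.restrict (parabolicCylinder R (0 : ℝ × EuclideanSpace ℝ (Fin 3))))) atTop (𝓝 0)) →
          ∀ σ : ℝ, (∀ᵐ z ∂(volume.restrict (Iio (0 : ℝ) ×ˢ (univ : Set (EuclideanSpace ℝ (Fin 3))))), nsRescale (Real.exp σ) v z.1 z.2 = v z.1 z.2) → σ = 0) ∧
        ∃ lam : ℕ → ℝ, (∀ n, 0 < lam n) ∧ Tendsto lam atTop (𝓝 0) ∧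
          ∀ K : Set (ℝ × EuclideanSpace ℝ (Fin 3)), IsCompact K → K ⊆ Iic (0 : ℝ) ×ˢ univ →
            Tendsto (fun n => eLpNorm (fun z : ℝ × EuclideanSpace ℝ (Fin 3) =>
              nsRescale (lam n) u z.1 z.2 - nsRescale (lam n) w z.1 z.2) 3 (volume.restrict K))
              atTop (𝓝 0)) := by
  intro u p G C hsw hwg hI hdec hsing
  obtain ⟨w, q, H, hsww, hwgw, hIw, hdecw, hsingw, hrec, lam, hlam, hlam0, hshadow⟩ :=
    stub_prProximalReduction u p G C hsw hwg hI hdec hsing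
  obtain ⟨Λ, hΛ1, hT4⟩ := stub_prHullDichotomy C (typeIBound (Iio (0 : ℝ) ×ˢ univ) w q H) hIw
  obtain ⟨-, hdich⟩ := hT4 w q H hsww hwgw le_rfl hdecw hsingw hrec
  rcases hdich with ⟨σ₀, hσ₀, hstab⟩ | hfree
  swap
  · exact Or.inr ⟨w, q, H, hsww, hwgw, hIw, hdecw, hsingw, hrec, hfree, lam, hlam, hlam0, hshadow⟩
  left
  have hσ₀pos : 0 < σ₀ := (Real.log_pos hΛ1).trans_le hσ₀
  -- `w_{λₙ} = w_{e^{rₙ}}` a.e. with `rₙ ∈ [0, σ₀]`; Bolzano–Weierstrass: `r (φ n) → r*`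
  obtain ⟨r, hrI, hae⟩ := prBD_reduce_scales hσ₀pos (fun k => (hstab _).2 ⟨k, rfl⟩) hlam
  obtain ⟨rs, -, φ, hφ, hrφ⟩ := tendsto_subseq_of_bounded (Metric.isBounded_Icc 0 σ₀) hrI
  -- the DSS blow-up limit `w' = w_{e^{r*}}`
  have hc : 0 < Real.exp rs := Real.exp_pos rs
  obtain ⟨hsw', hwg', hI'⟩ := zoom_slabProfile hsww hwgw hc
  have hmw : ∀ R : ℝ, 0 < R → MemLp (uncurry w) 3
      (volume.restrict (parabolicCylinder R (0 : ℝ × EuclideanSpace ℝ (Fin 3)))) :=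
    fun R hR => memLp_three_of_slabProfile hwgw hIw hR
  refine ⟨nsRescale (Real.exp rs) w,
    Real.exp rs ^ 2 • stPull (Real.exp rs ^ 2) (Real.exp rs) (0 : ℝ) (0 : EuclideanSpace ℝ (Fin 3)) q,
    Real.exp rs ^ 2 • stPull (Real.exp rs ^ 2) (Real.exp rs) (0 : ℝ) (0 : EuclideanSpace ℝ (Fin 3)) H,
    ?_, ?_, ?_, hdecw.nsRescale hc, ?_,
    ⟨Real.exp σ₀, Real.one_lt_exp_iff.2 hσ₀pos,
      prSL_ae_nsRescale_comm_of_ae hc ((hstab σ₀).2 ⟨1, by simp⟩)⟩,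
    fun n => lam (φ n), fun n => hlam (φ n), hlam0.comp hφ.tendsto_atTop, fun R hR => ?_⟩
  · rw [nsRescale_eq_zoom]; exact hsw'
  · rw [nsRescale_eq_zoom]; exact hwg'
  · rw [nsRescale_eq_zoom, hI']; exact hIw
  · rw [nsRescale_eq_zoom]; exact isBackwardSingularPoint_zoom hsingw hc
  -- ## `u_{λ_{φ n}} → w'` in `L³(Q(0, R))`: the two vanishing majorants
  have hK : IsCompact (Icc (-R ^ 2) 0 ×ˢ closedBall (0 : EuclideanSpace ℝ (Fin 3)) R) :=
    isCompact_Icc.prod (isCompact_closedBall 0 R)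
  have hKs : Icc (-R ^ 2) 0 ×ˢ closedBall (0 : EuclideanSpace ℝ (Fin 3)) R ⊆ Iic (0 : ℝ) ×ˢ univ :=
    prod_mono Icc_subset_Iic_self (subset_univ _)
  have hA : Tendsto (fun n => eLpNorm (uncurry (nsRescale (lam (φ n)) u) -
      uncurry (nsRescale (lam (φ n)) w)) 3
      (volume.restrict (Icc (-R ^ 2) 0 ×ˢ closedBall (0 : EuclideanSpace ℝ (Fin 3)) R))) atTop (𝓝 0) :=
    (hshadow _ hK hKs).comp hφ.tendsto_atTop
  have hB : Tendsto (fun n => eLpNorm (uncurry (nsRescale (Real.exp (r (φ n))) w) -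
      uncurry (nsRescale (Real.exp rs) w)) 3
      (volume.restrict (parabolicCylinder R (0 : ℝ × EuclideanSpace ℝ (Fin 3))))) atTop (𝓝 0) :=
    stub_prJointContinuity (fun _ => w) w (fun _ R' hR' => hmw R' hR') hmw
      (fun R' hR' => by simp only [sub_self, eLpNorm_zero]; exact tendsto_const_nhds)
      (fun n => Real.exp (r (φ n))) (Real.exp rs) (fun n => Real.exp_pos _) hc
      ((Real.continuous_exp.tendsto rs).comp hrφ) R hR
  have hsum := hA.add hB
  rw [add_zero] at hsum
  refine tendsto_of_tendsto_of_tendsto_of_le_of_le tendsto_const_nhds hsum (fun _ => zero_le)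
    fun n => ?_
  -- Minkowski through `w_{λ_{φ n}} = w_{e^{r_{φ n}}}` (a.e. on the ball)
  have hm1 := (prBD_memLp_nsRescale hwg hI (hlam (φ n)) hR).1
  have hm2 := (prBD_memLp_nsRescale hwgw hIw (hlam (φ n)) hR).1
  have hm3 := (prBD_memLp_nsRescale hwgw hIw hc hR).1
  have hae' : (uncurry (nsRescale (lam (φ n)) w) : ℝ × EuclideanSpace ℝ (Fin 3) → EuclideanSpace ℝ (Fin 3))
      =ᵐ[volume.restrict (parabolicCylinder R (0 : ℝ × EuclideanSpace ℝ (Fin 3)))]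
      uncurry (nsRescale (Real.exp (r (φ n))) w) :=
    ae_restrict_of_ae_restrict_of_subset (parabolicCylinder_origin_subset_slab R) (hae (φ n))
  calc eLpNorm (uncurry (nsRescale (lam (φ n)) u) - uncurry (nsRescale (Real.exp rs) w)) 3
        (volume.restrict (parabolicCylinder R (0 : ℝ × EuclideanSpace ℝ (Fin 3))))
      = eLpNorm ((uncurry (nsRescale (lam (φ n)) u) - uncurry (nsRescale (lam (φ n)) w)) +
          (uncurry (nsRescale (lam (φ n)) w) - uncurry (nsRescale (Real.exp rs) w))) 3
          (volume.restrict (parabolicCylinder R (0 : ℝ × EuclideanSpace ℝ (Fin 3)))) := by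
        rw [sub_add_sub_cancel]
    _ ≤ eLpNorm (uncurry (nsRescale (lam (φ n)) u) - uncurry (nsRescale (lam (φ n)) w)) 3
          (volume.restrict (parabolicCylinder R (0 : ℝ × EuclideanSpace ℝ (Fin 3)))) +
        eLpNorm (uncurry (nsRescale (lam (φ n)) w) - uncurry (nsRescale (Real.exp rs) w)) 3
          (volume.restrict (parabolicCylinder R (0 : ℝ × EuclideanSpace ℝ (Fin 3)))) :=
        eLpNorm_add_le (hm1.sub hm2) (hm2.sub hm3) (by norm_num)
    _ ≤ _ := add_le_add
        (eLpNorm_mono_measure _ (Measure.restrict_mono (prBD_cylinder_subset R) le_rfl))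
        (eLpNorm_congr_ae (hae'.sub (ae_eq_refl _))).le

end Summit.NavierStokesRegularity.NavierStokesRegularity.Theorems

end
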